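import Literature.AlgebraicGeometry.GroupSchemes.BirationalGroupLawStrictification
import Mathlib.CategoryTheory.MorphismProperty.Limits
import HarnessLib

/-!
# The translate chart of a strict birational group law at a section (Artin, *Néron models*, §2:
# «let `V_s` be another copy of `V`, thought of as the translate `V_s = {as | a ∈ V}`»)

Topic `Literature/AlgebraicGeometry/GroupSchemes`, namespace `Literature.AlgebraicGeometry.GroupSchemes`.
KERNEL ONLY: theorems over `StrictBirationalGroupLaw.lean` / `BirationalGroupLawStrictification.lean`; no definition,
no named fact, no instance, no `sorry`.  Cell `hodgecm-mathlib` (D-0151), road W (Néron capital; item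
stmt-HodgeConjecture-24834, sub-line `koizumi_strictly_local`), piece (G1) of the W1c design note
(`A-provers/A-p06/W1c-DESIGN.A-p06g5.md`): the data of ONE gluing step of Weil's construction in Artin's form.

For an `S`-scheme `𝒳`, a birational group law `L` on `𝒳` and a SECTION `s : S ⟶ 𝒳` of `𝒳 → S`:

* `isPullback_sectionSlice` — the slice embedding `σ_s = (id, s∘π) : 𝒳 → 𝒳 ×_S 𝒳` is the base change of `s` along
  the second projection (so `𝒳 ≅ (𝒳 ×_S 𝒳) ×_{snd, 𝒳, s} S`); `exists_sectionSlice_eq` — hence every point of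
  `𝒳 ×_S 𝒳` whose second coordinate is a value of `s` lies on the slice (no residue-field bookkeeping needed);
* `exists_rightTranslate` — **the translate chart**: there are an open `A_s ⊆ 𝒳` («the `a` with `a·s` defined»: the
  points `a` with `σ_s(a) ∈ dom`) and an OPEN IMMERSION `ρ_s : A_s ↪ 𝒳` over `S` («`a ↦ a·s`», the base change of
  the right shear `Ψ : dom ↪ 𝒳 ×_S 𝒳` along `σ_s`), computing `mul` at the points `(a, s(πa))`; if `L` is STRICT and
  the fibres of `𝒳 → S` are preirreducible, `A_s` and `ρ_s(A_s)` are dense in every fibre of `𝒳 → S`.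
  These are the two open immersions `A_s ↪ 𝒳` (inclusion) and `A_s ↪ 𝒳` (`ρ_s`) along which Artin glues
  `V′ = V ∪_{W_s} V_s` ([Artin1986NeronModels] §2 p. 222; the separatedness of the push-out is Conrad's criterion,
  tree `Morphisms/SeparatedGluing`, applied to the graph of `ρ_s`, whose closedness is [Artin1986NeronModels]
  Lemma 2.3 — not in this file).

[Artin1986NeronModels] M. Artin, *Néron models*, in Cornell–Silverman, *Arithmetic Geometry* (1986), §2, p. 222
(held: `book:cornellnd-arithmetic-geometry` p0293); [EdixhovenRomagny] Lemmas 3.19–3.20 (`ψ(a)`, right translations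
as birational maps `U'_a ≅ V'_a`), arXiv:1204.1799v2 (held); [BLRNeronModels1990] §5.1 (not held).
HC_CM is not proved here; nothing here changes the floor.

## References
* [Artin1986NeronModels] M. Artin, *Néron models*, in *Arithmetic Geometry* (Cornell, Silverman eds.), Springer 1986, §2.
* [EdixhovenRomagny] B. Edixhoven, M. Romagny, *Group schemes out of birational group laws, Néron models*, Panor. Synthèses 47 (2015), §3.
* [BLRNeronModels1990] S. Bosch, W. Lütkebohmert, M. Raynaud, *Néron Models*, Springer 1990, §5.1.
-/

noncomputable section

namespace Literature.AlgebraicGeometry.GroupSchemes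

open CategoryTheory CategoryTheory.Limits _root_.AlgebraicGeometry MonoidalCategory CartesianMonoidalCategory
open MonObj GrpObj
open scoped CategoryTheory.Obj

universe u

variable {S : Scheme.{u}} {𝒳 : Over S}

/-! ## §1. The slice of `𝒳 ×_S 𝒳` at a section -/

section Slice

variable (𝒳) (s : S ⟶ 𝒳.left) (hs : s ≫ 𝒳.hom = 𝟙 S)

/-- **The slice embedding at a section is a base change of the section**: the square
`𝒳 —σ_s→ 𝒳 ×_S 𝒳 —snd→ 𝒳 ← s — S ← π — 𝒳`, `σ_s = (id, s ∘ π)`, is cartesian.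
[cite: Artin1986NeronModels, §2 p. 222 (the translate `V_s`)] [cite: EdixhovenRomagny, Lemma 3.19] -/
theorem isPullback_sectionSlice :
    IsPullback (lift (𝟙 𝒳) (Over.homMk (𝒳.hom ≫ s) (by rw [Category.assoc, hs, Category.comp_id]) : 𝒳 ⟶ 𝒳)).left
      𝒳.hom (snd 𝒳 𝒳).left s := by
  set c : 𝒳 ⟶ 𝒳 := Over.homMk (𝒳.hom ≫ s) (by rw [Category.assoc, hs, Category.comp_id]) with hc
  have hsq : (lift (𝟙 𝒳) c).left ≫ (snd 𝒳 𝒳).left = 𝒳.hom ≫ s := by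
    change ((lift (𝟙 𝒳) c) ≫ snd 𝒳 𝒳).left = _
    rw [lift_snd]
    rfl
  refine IsPullback.of_isLimit' ⟨hsq⟩ (PullbackCone.IsLimit.mk hsq (fun t => t.fst ≫ (fst 𝒳 𝒳).left)
    (fun t => ?_) (fun t => ?_) (fun t m hm₁ _ => ?_))
  · -- `(z ≫ fst) ≫ σ = z`
    have hz : t.fst ≫ (𝒳 ⊗ 𝒳).hom = t.snd := by
      rw [← Over.w (snd 𝒳 𝒳), ← Category.assoc, t.condition, Category.assoc, hs, Category.comp_id]
    apply pullback.hom_ext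
    · change ((t.fst ≫ (fst 𝒳 𝒳).left) ≫ (lift (𝟙 𝒳) c).left) ≫ (fst 𝒳 𝒳).left = t.fst ≫ (fst 𝒳 𝒳).left
      rw [Category.assoc, show (lift (𝟙 𝒳) c).left ≫ (fst 𝒳 𝒳).left = 𝟙 _ from by
        change (lift (𝟙 𝒳) c ≫ fst 𝒳 𝒳).left = _; rw [lift_fst]; rfl, Category.comp_id]
    · change ((t.fst ≫ (fst 𝒳 𝒳).left) ≫ (lift (𝟙 𝒳) c).left) ≫ (snd 𝒳 𝒳).left = t.fst ≫ (snd 𝒳 𝒳).left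
      rw [Category.assoc, hsq, ← Category.assoc, Category.assoc t.fst, Over.w (fst 𝒳 𝒳), hz]
      exact t.condition.symm
  · rw [Category.assoc, Over.w (fst 𝒳 𝒳), ← Over.w (snd 𝒳 𝒳), ← Category.assoc, t.condition, Category.assoc, hs,
      Category.comp_id]
  · rw [← hm₁, Category.assoc]
    change m = m ≫ (lift (𝟙 𝒳) c ≫ fst 𝒳 𝒳).left
    rw [lift_fst]
    exact (Category.comp_id m).symm

/-- **A point of `𝒳 ×_S 𝒳` whose second coordinate is a value of the section lies on the slice**: if
`snd w = s t` then `w = σ_s(a)` with `a = fst w` over `t`. [cite: Artin1986NeronModels, §2 p. 222] -/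
theorem exists_sectionSlice_eq (w : ↑(𝒳 ⊗ 𝒳).left) (t : S) (hw : (snd 𝒳 𝒳).left.base w = s.base t) :
    ∃ a : 𝒳.left,
      (lift (𝟙 𝒳) (Over.homMk (𝒳.hom ≫ s) (by rw [Category.assoc, hs, Category.comp_id]) : 𝒳 ⟶ 𝒳)).left.base a
        = w ∧ 𝒳.hom.base a = t :=
  Scheme.exists_preimage_of_isPullback (isPullback_sectionSlice 𝒳 s hs) w t hw

end Slice

/-! ## §2. The translate chart -/

namespace BirationalGroupLaw

variable (L : BirationalGroupLaw 𝒳) (s : S ⟶ 𝒳.left) (hs : s ≫ 𝒳.hom = 𝟙 S)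

/-- **The translate chart `ρ_s : A_s ↪ 𝒳`, `a ↦ a·s`, at a section `s`** ([Artin1986NeronModels] §2 p. 222 «let
`V_s` be another copy of `V`, thought of as the translate `V_s = {as | a ∈ V}`»; [EdixhovenRomagny] Lemma 3.19–3.20,
the right translation `ψ(a)`).  For a birational group law `L` on `𝒳/S` and a section `s` there are an open `A ⊆ 𝒳`
and an open immersion `ρ : A ↪ 𝒳` over `S` such that: `a ∈ A` iff the slice point `σ_s(a) = (a, s(πa))` lies in
`dom`; for `a ∈ A`, `σ_s(a) = ι z` for a point `z` of `dom` with `ρ a = mul z`; and the range of `ρ` is the set of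
products `mul z` over the points `z` of `dom` with second coordinate on the section.  (`ρ` is the base change of
the right shear `Ψ : dom ↪ 𝒳 ×_S 𝒳` along the slice `σ_s`.)  If moreover `L` is STRICT and the fibres of `𝒳 → S`
are preirreducible, `A` and `ρ(A)` are dense in every fibre of `𝒳 → S`.
[cite: Artin1986NeronModels, §2 p. 222] [cite: EdixhovenRomagny, Lemmas 3.19–3.20] -/
theorem exists_rightTranslate :
    ∃ (A : 𝒳.left.Opens) (ρ : (A : Scheme.{u}) ⟶ 𝒳.left),
      IsOpenImmersion ρ ∧ ρ ≫ 𝒳.hom = A.ι ≫ 𝒳.hom ∧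
      (∀ a : 𝒳.left, a ∈ A ↔
        (lift (𝟙 𝒳) (Over.homMk (𝒳.hom ≫ s) (by rw [Category.assoc, hs, Category.comp_id]) : 𝒳 ⟶ 𝒳)).left.base a
          ∈ L.dom) ∧
      (∀ a : ↥A, ∃ z : ↥L.dom,
        L.dom.ι.base z =
          (lift (𝟙 𝒳) (Over.homMk (𝒳.hom ≫ s) (by rw [Category.assoc, hs, Category.comp_id]) : 𝒳 ⟶ 𝒳)).left.base
            (A.ι.base a) ∧ ρ.base a = L.mul.base z) ∧
      (∀ z : ↥L.dom, (snd 𝒳 𝒳).left.base (L.dom.ι.base z) = s.base ((𝒳 ⊗ 𝒳).hom.base (L.dom.ι.base z)) →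
        ∃ a : ↥A, L.dom.ι.base z =
          (lift (𝟙 𝒳) (Over.homMk (𝒳.hom ≫ s) (by rw [Category.assoc, hs, Category.comp_id]) : 𝒳 ⟶ 𝒳)).left.base
            (A.ι.base a) ∧ ρ.base a = L.mul.base z) ∧
      (L.IsStrict → (∀ t : S, IsPreirreducible (𝒳.hom.base ⁻¹' {t})) →
        IsFibrewiseDense 𝒳.hom (A : Set 𝒳.left) ∧ IsFibrewiseDense 𝒳.hom (Set.range ρ.base)) := by
  haveI hΨo := L.isOpenImmersion_shearRight
  -- the slice embedding
  set c : 𝒳 ⟶ 𝒳 := Over.homMk (𝒳.hom ≫ s) (by rw [Category.assoc, hs, Category.comp_id]) with hc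
  set σ : 𝒳 ⟶ 𝒳 ⊗ 𝒳 := lift (𝟙 𝒳) c with hσ
  have hσ1 : σ.left ≫ (fst 𝒳 𝒳).left = 𝟙 _ := by
    change (σ ≫ fst 𝒳 𝒳).left = _; rw [hσ, lift_fst]; rfl
  have hσ2 : σ.left ≫ (snd 𝒳 𝒳).left = 𝒳.hom ≫ s := by
    change (σ ≫ snd 𝒳 𝒳).left = _; rw [hσ, lift_snd]; rfl
  have σ_snd_base : ∀ a, (snd 𝒳 𝒳).left.base (σ.left.base a) = s.base (𝒳.hom.base a) := fun a => by
    change (σ.left ≫ (snd 𝒳 𝒳).left).base a = (𝒳.hom ≫ s).base a; rw [hσ2]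
  have hΨ1 : L.shearRight.left ≫ (fst 𝒳 𝒳).left = L.mul :=
    congrArg CommaMorphism.left (LawData.shearRight_fst 𝒳 L.dom L.mul L.mul_comp)
  have hΨ2 : L.shearRight.left ≫ (snd 𝒳 𝒳).left = L.dom.ι ≫ (snd 𝒳 𝒳).left :=
    congrArg CommaMorphism.left (LawData.shearRight_snd 𝒳 L.dom L.mul L.mul_comp)
  have hfstS : (fst 𝒳 𝒳).left ≫ 𝒳.hom = (𝒳 ⊗ 𝒳).hom := Over.w (fst 𝒳 𝒳)
  have hsndS : (snd 𝒳 𝒳).left ≫ 𝒳.hom = (𝒳 ⊗ 𝒳).hom := Over.w (snd 𝒳 𝒳)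
  -- two morphisms into `𝒳 ×_S 𝒳` agree iff their coordinates agree
  have hext : ∀ {T : Scheme.{u}} (f g : T ⟶ (𝒳 ⊗ 𝒳).left),
      f ≫ (fst 𝒳 𝒳).left = g ≫ (fst 𝒳 𝒳).left → f ≫ (snd 𝒳 𝒳).left = g ≫ (snd 𝒳 𝒳).left → f = g :=
    fun f g h1 h2 => pullback.hom_ext h1 h2
  -- a morphism `a : T → 𝒳` followed by `σ` has coordinates `(a, a ≫ π ≫ s)`
  have hσa : ∀ {T : Scheme.{u}} (a : T ⟶ 𝒳.left) (g : T ⟶ (𝒳 ⊗ 𝒳).left),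
      g ≫ (fst 𝒳 𝒳).left = a → g ≫ (snd 𝒳 𝒳).left = a ≫ 𝒳.hom ≫ s → a ≫ σ.left = g := by
    intro T a g h1 h2
    refine hext _ _ ?_ ?_
    · rw [Category.assoc, hσ1, Category.comp_id, h1]
    · rw [Category.assoc, hσ2, h2]
  -- `σ.left` is a (split) monomorphism
  haveI : Mono σ.left := ⟨fun f g h => by
    have := congrArg (· ≫ (fst 𝒳 𝒳).left) h
    simp only [Category.assoc, hσ1, Category.comp_id] at this
    exact this⟩
  -- the open `A = σ⁻¹ dom` and the lift `e : A → dom`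
  let A : 𝒳.left.Opens := σ.left ⁻¹ᵁ L.dom
  have memA : ∀ a : 𝒳.left, a ∈ A ↔ σ.left.base a ∈ L.dom := fun a => Iff.rfl
  have hAι : ∀ a : ↥A, A.ι.base a ∈ A := fun a => by
    rw [← SetLike.mem_coe, ← Scheme.Opens.range_ι]; exact ⟨a, rfl⟩
  have hrangeA : ∀ {T : Scheme.{u}} (a : T ⟶ 𝒳.left),
      Set.range (a ≫ σ.left).base ⊆ Set.range L.dom.ι.base → Set.range a.base ⊆ Set.range A.ι.base := by
    intro T a h
    rintro _ ⟨x, rfl⟩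
    rw [Scheme.Opens.range_ι]
    change σ.left.base (a.base x) ∈ L.dom
    rw [← SetLike.mem_coe, ← Scheme.Opens.range_ι]
    exact h ⟨x, rfl⟩
  have hr : Set.range (A.ι ≫ σ.left).base ⊆ Set.range L.dom.ι.base := by
    rintro _ ⟨a, rfl⟩
    rw [Scheme.Opens.range_ι]
    exact (memA _).1 (hAι a)
  let e : (A : Scheme.{u}) ⟶ (L.dom : Scheme.{u}) := IsOpenImmersion.lift L.dom.ι (A.ι ≫ σ.left) hr
  have he : e ≫ L.dom.ι = A.ι ≫ σ.left := IsOpenImmersion.lift_fac _ _ _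
  have he_base : ∀ a, L.dom.ι.base (e.base a) = σ.left.base (A.ι.base a) := fun a => by
    change (e ≫ L.dom.ι).base a = (A.ι ≫ σ.left).base a; rw [he]
  -- the translate `ρ = mul ∘ e`, a morphism over `S`
  let ρ : (A : Scheme.{u}) ⟶ 𝒳.left := e ≫ L.mul
  have hρS : ρ ≫ 𝒳.hom = A.ι ≫ 𝒳.hom := by
    change (e ≫ L.mul) ≫ 𝒳.hom = _
    rw [Category.assoc, L.mul_comp, ← Category.assoc, he, Category.assoc, Over.w σ]
  -- the square `A —e→ dom —Ψ→ 𝒳 ×_S 𝒳 ← σ — 𝒳 ← ρ — A` commutes …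
  have hsq : e ≫ L.shearRight.left = ρ ≫ σ.left := by
    refine (hσa ρ (e ≫ L.shearRight.left) ?_ ?_).symm
    · exact (Category.assoc _ _ _).trans (congrArg (e ≫ ·) hΨ1)
    · calc (e ≫ L.shearRight.left) ≫ (snd 𝒳 𝒳).left = e ≫ (L.shearRight.left ≫ (snd 𝒳 𝒳).left) :=
            Category.assoc _ _ _
        _ = e ≫ (L.dom.ι ≫ (snd 𝒳 𝒳).left) := congrArg (e ≫ ·) hΨ2
        _ = (e ≫ L.dom.ι) ≫ (snd 𝒳 𝒳).left := (Category.assoc _ _ _).symm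
        _ = (A.ι ≫ σ.left) ≫ (snd 𝒳 𝒳).left := congrArg (· ≫ (snd 𝒳 𝒳).left) he
        _ = A.ι ≫ (σ.left ≫ (snd 𝒳 𝒳).left) := Category.assoc _ _ _
        _ = A.ι ≫ (𝒳.hom ≫ s) := congrArg (A.ι ≫ ·) hσ2
        _ = (A.ι ≫ 𝒳.hom) ≫ s := (Category.assoc _ _ _).symm
        _ = (ρ ≫ 𝒳.hom) ≫ s := congrArg (· ≫ s) hρS.symm
        _ = ρ ≫ 𝒳.hom ≫ s := Category.assoc _ _ _
  -- facts about an arbitrary cone over `(Ψ, σ)`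
  have cone_mul : ∀ t : PullbackCone L.shearRight.left σ.left,
      t.fst ≫ L.mul = t.snd := fun t => by
    have := congrArg (· ≫ (fst 𝒳 𝒳).left) t.condition
    simp only [Category.assoc, hΨ1, hσ1, Category.comp_id] at this
    exact this
  have cone_snd : ∀ t : PullbackCone L.shearRight.left σ.left,
      t.fst ≫ L.dom.ι ≫ (snd 𝒳 𝒳).left = t.snd ≫ 𝒳.hom ≫ s := fun t => by
    have := congrArg (· ≫ (snd 𝒳 𝒳).left) t.condition
    simp only [Category.assoc, hΨ2, hσ2] at this
    exact this
  -- the first coordinate `a_t` of `t.fst` satisfies `a_t ≫ σ = t.fst ≫ ι`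
  have cone_slice : ∀ t : PullbackCone L.shearRight.left σ.left,
      (t.fst ≫ L.dom.ι ≫ (fst 𝒳 𝒳).left) ≫ σ.left = t.fst ≫ L.dom.ι := fun t => by
    refine hσa _ _ (by simp only [Category.assoc]) ?_
    have hmulS : L.dom.ι ≫ (fst 𝒳 𝒳).left ≫ 𝒳.hom = L.mul ≫ 𝒳.hom := by rw [hfstS, L.mul_comp]
    calc (t.fst ≫ L.dom.ι) ≫ (snd 𝒳 𝒳).left = t.fst ≫ L.dom.ι ≫ (snd 𝒳 𝒳).left := Category.assoc _ _ _
      _ = t.snd ≫ 𝒳.hom ≫ s := cone_snd t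
      _ = (t.fst ≫ L.mul) ≫ 𝒳.hom ≫ s := by rw [cone_mul t]
      _ = t.fst ≫ (L.mul ≫ 𝒳.hom) ≫ s := by simp only [Category.assoc]
      _ = t.fst ≫ (L.dom.ι ≫ (fst 𝒳 𝒳).left ≫ 𝒳.hom) ≫ s := congrArg (fun φ => t.fst ≫ φ ≫ s) hmulS.symm
      _ = (t.fst ≫ L.dom.ι ≫ (fst 𝒳 𝒳).left) ≫ 𝒳.hom ≫ s := by simp only [Category.assoc]
  have cone_range : ∀ t : PullbackCone L.shearRight.left σ.left,
      Set.range (t.fst ≫ L.dom.ι ≫ (fst 𝒳 𝒳).left).base ⊆ Set.range A.ι.base := fun t =>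
    hrangeA _ (by rw [cone_slice t]; rintro _ ⟨x, rfl⟩; exact ⟨t.fst.base x, rfl⟩)
  -- … and is cartesian, so `ρ` is an open immersion (base change of `Ψ`)
  have hpb : IsPullback e ρ L.shearRight.left σ.left := by
    refine IsPullback.of_isLimit' ⟨hsq⟩ (PullbackCone.IsLimit.mk hsq
      (fun t => IsOpenImmersion.lift A.ι (t.fst ≫ L.dom.ι ≫ (fst 𝒳 𝒳).left) (cone_range t))
      (fun t => ?_) (fun t => ?_) (fun t m hm₁ _ => ?_))
    · -- `lift ≫ e = t.fst`
      rw [← cancel_mono L.dom.ι, Category.assoc, he, ← Category.assoc, IsOpenImmersion.lift_fac]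
      exact cone_slice t
    · -- `lift ≫ ρ = t.snd`
      change IsOpenImmersion.lift A.ι (t.fst ≫ L.dom.ι ≫ (fst 𝒳 𝒳).left) _ ≫ (e ≫ L.mul) = t.snd
      have hfac : IsOpenImmersion.lift A.ι (t.fst ≫ L.dom.ι ≫ (fst 𝒳 𝒳).left) (cone_range t) ≫ e = t.fst := by
        rw [← cancel_mono L.dom.ι, Category.assoc, he, ← Category.assoc, IsOpenImmersion.lift_fac]
        exact cone_slice t
      rw [← Category.assoc, hfac]
      exact cone_mul t
    · -- uniqueness
      rw [← cancel_mono A.ι, IsOpenImmersion.lift_fac, ← hm₁]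
      simp only [Category.assoc]
      rw [reassoc_of% he, hσ1, Category.comp_id]
  have hρo : IsOpenImmersion ρ :=
    MorphismProperty.IsStableUnderBaseChange.of_isPullback (P := @IsOpenImmersion) hpb hΨo
  -- pointwise description
  have hpt : ∀ a : ↥A, ∃ z : ↥L.dom, L.dom.ι.base z = σ.left.base (A.ι.base a) ∧ ρ.base a = L.mul.base z :=
    fun a => ⟨e.base a, he_base a, rfl⟩
  have hsurj : ∀ z : ↥L.dom, (snd 𝒳 𝒳).left.base (L.dom.ι.base z) = s.base ((𝒳 ⊗ 𝒳).hom.base (L.dom.ι.base z)) →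
      ∃ a : ↥A, L.dom.ι.base z = σ.left.base (A.ι.base a) ∧ ρ.base a = L.mul.base z := by
    intro z hz
    obtain ⟨a₀, ha₀, -⟩ := exists_sectionSlice_eq 𝒳 s hs (L.dom.ι.base z) _ hz
    have hmem : a₀ ∈ A := (memA a₀).2 (by
      rw [ha₀, ← SetLike.mem_coe, ← Scheme.Opens.range_ι]; exact ⟨z, rfl⟩)
    have : a₀ ∈ Set.range A.ι.base := by rw [Scheme.Opens.range_ι]; exact hmem
    obtain ⟨a, ha⟩ := this
    refine ⟨a, by rw [ha, ha₀], ?_⟩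
    have hz' : e.base a = z := L.dom.ι.isOpenEmbedding.injective (by rw [he_base, ha, ha₀])
    change L.mul.base (e.base a) = _
    rw [hz']
  refine ⟨A, ρ, hρo, hρS, memA, hpt, hsurj, fun hstrict hirr => ?_⟩
  -- densities from strictness (slice of `dom` over the point `s t` in the `snd` direction)
  haveI := hρo
  have hA : IsFibrewiseDense 𝒳.hom (A : Set 𝒳.left) := by
    refine IsFibrewiseDense.of_isOpen_of_forall_nonempty A.isOpen hirr fun t ⟨v, hv⟩ => ?_
    obtain ⟨⟨-, hdense⟩, -, -⟩ := hstrict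
    have hvF : σ.left.base v ∈ (snd 𝒳 𝒳).left.base ⁻¹' {s.base t} := by
      change (snd 𝒳 𝒳).left.base (σ.left.base v) = s.base t
      rw [σ_snd_base]
      exact congrArg s.base hv
    obtain ⟨w, hwdom, hwF⟩ := hdense.nonempty_inter_fibre ⟨_, hvF⟩
    obtain ⟨a, ha, hat⟩ := exists_sectionSlice_eq 𝒳 s hs w t hwF
    exact ⟨a, (memA a).2 (by rw [ha]; exact hwdom), hat⟩
  refine ⟨hA, IsFibrewiseDense.of_isOpen_of_forall_nonempty ρ.isOpenEmbedding.isOpen_range hirr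
    fun t ht => ?_⟩
  obtain ⟨a₀, ha₀A, ha₀t⟩ := hA.nonempty_inter_fibre ht
  have : a₀ ∈ Set.range A.ι.base := by rw [Scheme.Opens.range_ι]; exact ha₀A
  obtain ⟨a, rfl⟩ := this
  refine ⟨ρ.base a, ⟨a, rfl⟩, ?_⟩
  change (ρ ≫ 𝒳.hom).base a = t
  rw [hρS]
  exact ha₀t


/-! ## §3. The translate chart with its MORPHISM-LEVEL description (appended; cell `hodgecm-mathlib`, road W (W1)
(G3b) layer L0 — B-p21) -/

/-- **The translate chart `ρ_s = mul ∘ e` as a MORPHISM** — `exists_rightTranslate` with the two identities its proof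
constructs but did not export: the lift `e : A → dom` of the slice `σ_s|_A` (`e ≫ ι = A.ι ≫ σ_s`) and `ρ = e ≫ mul`.
(The pointwise clauses of `exists_rightTranslate` do not determine `ρ` as a morphism; the charts of [Artin1986NeronModels]
§2 — Lemma 2.4 and the last paragraph — compute with `ρ` and `ρ⁻¹` as morphisms.)  Same proof, same `A`, `e`, `ρ`.
[cite: Artin1986NeronModels, §2 p. 222] [cite: EdixhovenRomagny, Lemmas 3.19–3.20] -/
theorem exists_rightTranslate' :
    ∃ (A : 𝒳.left.Opens) (e : (A : Scheme.{u}) ⟶ (L.dom : Scheme.{u})) (ρ : (A : Scheme.{u}) ⟶ 𝒳.left),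
      e ≫ L.dom.ι = A.ι ≫
        (lift (𝟙 𝒳) (Over.homMk (𝒳.hom ≫ s) (by rw [Category.assoc, hs, Category.comp_id]) : 𝒳 ⟶ 𝒳)).left ∧
      ρ = e ≫ L.mul ∧
      IsOpenImmersion ρ ∧ ρ ≫ 𝒳.hom = A.ι ≫ 𝒳.hom ∧
      (∀ a : 𝒳.left, a ∈ A ↔
        (lift (𝟙 𝒳) (Over.homMk (𝒳.hom ≫ s) (by rw [Category.assoc, hs, Category.comp_id]) : 𝒳 ⟶ 𝒳)).left.base a
          ∈ L.dom) ∧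
      (∀ a : ↥A, ∃ z : ↥L.dom,
        L.dom.ι.base z =
          (lift (𝟙 𝒳) (Over.homMk (𝒳.hom ≫ s) (by rw [Category.assoc, hs, Category.comp_id]) : 𝒳 ⟶ 𝒳)).left.base
            (A.ι.base a) ∧ ρ.base a = L.mul.base z) ∧
      (∀ z : ↥L.dom, (snd 𝒳 𝒳).left.base (L.dom.ι.base z) = s.base ((𝒳 ⊗ 𝒳).hom.base (L.dom.ι.base z)) →
        ∃ a : ↥A, L.dom.ι.base z =
          (lift (𝟙 𝒳) (Over.homMk (𝒳.hom ≫ s) (by rw [Category.assoc, hs, Category.comp_id]) : 𝒳 ⟶ 𝒳)).left.base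
            (A.ι.base a) ∧ ρ.base a = L.mul.base z) ∧
      (L.IsStrict → (∀ t : S, IsPreirreducible (𝒳.hom.base ⁻¹' {t})) →
        IsFibrewiseDense 𝒳.hom (A : Set 𝒳.left) ∧ IsFibrewiseDense 𝒳.hom (Set.range ρ.base)) := by
  haveI hΨo := L.isOpenImmersion_shearRight
  -- the slice embedding
  set c : 𝒳 ⟶ 𝒳 := Over.homMk (𝒳.hom ≫ s) (by rw [Category.assoc, hs, Category.comp_id]) with hc
  set σ : 𝒳 ⟶ 𝒳 ⊗ 𝒳 := lift (𝟙 𝒳) c with hσ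
  have hσ1 : σ.left ≫ (fst 𝒳 𝒳).left = 𝟙 _ := by
    change (σ ≫ fst 𝒳 𝒳).left = _; rw [hσ, lift_fst]; rfl
  have hσ2 : σ.left ≫ (snd 𝒳 𝒳).left = 𝒳.hom ≫ s := by
    change (σ ≫ snd 𝒳 𝒳).left = _; rw [hσ, lift_snd]; rfl
  have σ_snd_base : ∀ a, (snd 𝒳 𝒳).left.base (σ.left.base a) = s.base (𝒳.hom.base a) := fun a => by
    change (σ.left ≫ (snd 𝒳 𝒳).left).base a = (𝒳.hom ≫ s).base a; rw [hσ2]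
  have hΨ1 : L.shearRight.left ≫ (fst 𝒳 𝒳).left = L.mul :=
    congrArg CommaMorphism.left (LawData.shearRight_fst 𝒳 L.dom L.mul L.mul_comp)
  have hΨ2 : L.shearRight.left ≫ (snd 𝒳 𝒳).left = L.dom.ι ≫ (snd 𝒳 𝒳).left :=
    congrArg CommaMorphism.left (LawData.shearRight_snd 𝒳 L.dom L.mul L.mul_comp)
  have hfstS : (fst 𝒳 𝒳).left ≫ 𝒳.hom = (𝒳 ⊗ 𝒳).hom := Over.w (fst 𝒳 𝒳)
  have hsndS : (snd 𝒳 𝒳).left ≫ 𝒳.hom = (𝒳 ⊗ 𝒳).hom := Over.w (snd 𝒳 𝒳)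
  -- two morphisms into `𝒳 ×_S 𝒳` agree iff their coordinates agree
  have hext : ∀ {T : Scheme.{u}} (f g : T ⟶ (𝒳 ⊗ 𝒳).left),
      f ≫ (fst 𝒳 𝒳).left = g ≫ (fst 𝒳 𝒳).left → f ≫ (snd 𝒳 𝒳).left = g ≫ (snd 𝒳 𝒳).left → f = g :=
    fun f g h1 h2 => pullback.hom_ext h1 h2
  -- a morphism `a : T → 𝒳` followed by `σ` has coordinates `(a, a ≫ π ≫ s)`
  have hσa : ∀ {T : Scheme.{u}} (a : T ⟶ 𝒳.left) (g : T ⟶ (𝒳 ⊗ 𝒳).left),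
      g ≫ (fst 𝒳 𝒳).left = a → g ≫ (snd 𝒳 𝒳).left = a ≫ 𝒳.hom ≫ s → a ≫ σ.left = g := by
    intro T a g h1 h2
    refine hext _ _ ?_ ?_
    · rw [Category.assoc, hσ1, Category.comp_id, h1]
    · rw [Category.assoc, hσ2, h2]
  -- `σ.left` is a (split) monomorphism
  haveI : Mono σ.left := ⟨fun f g h => by
    have := congrArg (· ≫ (fst 𝒳 𝒳).left) h
    simp only [Category.assoc, hσ1, Category.comp_id] at this
    exact this⟩
  -- the open `A = σ⁻¹ dom` and the lift `e : A → dom`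
  let A : 𝒳.left.Opens := σ.left ⁻¹ᵁ L.dom
  have memA : ∀ a : 𝒳.left, a ∈ A ↔ σ.left.base a ∈ L.dom := fun a => Iff.rfl
  have hAι : ∀ a : ↥A, A.ι.base a ∈ A := fun a => by
    rw [← SetLike.mem_coe, ← Scheme.Opens.range_ι]; exact ⟨a, rfl⟩
  have hrangeA : ∀ {T : Scheme.{u}} (a : T ⟶ 𝒳.left),
      Set.range (a ≫ σ.left).base ⊆ Set.range L.dom.ι.base → Set.range a.base ⊆ Set.range A.ι.base := by
    intro T a h
    rintro _ ⟨x, rfl⟩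
    rw [Scheme.Opens.range_ι]
    change σ.left.base (a.base x) ∈ L.dom
    rw [← SetLike.mem_coe, ← Scheme.Opens.range_ι]
    exact h ⟨x, rfl⟩
  have hr : Set.range (A.ι ≫ σ.left).base ⊆ Set.range L.dom.ι.base := by
    rintro _ ⟨a, rfl⟩
    rw [Scheme.Opens.range_ι]
    exact (memA _).1 (hAι a)
  let e : (A : Scheme.{u}) ⟶ (L.dom : Scheme.{u}) := IsOpenImmersion.lift L.dom.ι (A.ι ≫ σ.left) hr
  have he : e ≫ L.dom.ι = A.ι ≫ σ.left := IsOpenImmersion.lift_fac _ _ _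
  have he_base : ∀ a, L.dom.ι.base (e.base a) = σ.left.base (A.ι.base a) := fun a => by
    change (e ≫ L.dom.ι).base a = (A.ι ≫ σ.left).base a; rw [he]
  -- the translate `ρ = mul ∘ e`, a morphism over `S`
  let ρ : (A : Scheme.{u}) ⟶ 𝒳.left := e ≫ L.mul
  have hρS : ρ ≫ 𝒳.hom = A.ι ≫ 𝒳.hom := by
    change (e ≫ L.mul) ≫ 𝒳.hom = _
    rw [Category.assoc, L.mul_comp, ← Category.assoc, he, Category.assoc, Over.w σ]
  -- the square `A —e→ dom —Ψ→ 𝒳 ×_S 𝒳 ← σ — 𝒳 ← ρ — A` commutes …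
  have hsq : e ≫ L.shearRight.left = ρ ≫ σ.left := by
    refine (hσa ρ (e ≫ L.shearRight.left) ?_ ?_).symm
    · exact (Category.assoc _ _ _).trans (congrArg (e ≫ ·) hΨ1)
    · calc (e ≫ L.shearRight.left) ≫ (snd 𝒳 𝒳).left = e ≫ (L.shearRight.left ≫ (snd 𝒳 𝒳).left) :=
            Category.assoc _ _ _
        _ = e ≫ (L.dom.ι ≫ (snd 𝒳 𝒳).left) := congrArg (e ≫ ·) hΨ2
        _ = (e ≫ L.dom.ι) ≫ (snd 𝒳 𝒳).left := (Category.assoc _ _ _).symm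
        _ = (A.ι ≫ σ.left) ≫ (snd 𝒳 𝒳).left := congrArg (· ≫ (snd 𝒳 𝒳).left) he
        _ = A.ι ≫ (σ.left ≫ (snd 𝒳 𝒳).left) := Category.assoc _ _ _
        _ = A.ι ≫ (𝒳.hom ≫ s) := congrArg (A.ι ≫ ·) hσ2
        _ = (A.ι ≫ 𝒳.hom) ≫ s := (Category.assoc _ _ _).symm
        _ = (ρ ≫ 𝒳.hom) ≫ s := congrArg (· ≫ s) hρS.symm
        _ = ρ ≫ 𝒳.hom ≫ s := Category.assoc _ _ _
  -- facts about an arbitrary cone over `(Ψ, σ)`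
  have cone_mul : ∀ t : PullbackCone L.shearRight.left σ.left,
      t.fst ≫ L.mul = t.snd := fun t => by
    have := congrArg (· ≫ (fst 𝒳 𝒳).left) t.condition
    simp only [Category.assoc, hΨ1, hσ1, Category.comp_id] at this
    exact this
  have cone_snd : ∀ t : PullbackCone L.shearRight.left σ.left,
      t.fst ≫ L.dom.ι ≫ (snd 𝒳 𝒳).left = t.snd ≫ 𝒳.hom ≫ s := fun t => by
    have := congrArg (· ≫ (snd 𝒳 𝒳).left) t.condition
    simp only [Category.assoc, hΨ2, hσ2] at this
    exact this
  -- the first coordinate `a_t` of `t.fst` satisfies `a_t ≫ σ = t.fst ≫ ι`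
  have cone_slice : ∀ t : PullbackCone L.shearRight.left σ.left,
      (t.fst ≫ L.dom.ι ≫ (fst 𝒳 𝒳).left) ≫ σ.left = t.fst ≫ L.dom.ι := fun t => by
    refine hσa _ _ (by simp only [Category.assoc]) ?_
    have hmulS : L.dom.ι ≫ (fst 𝒳 𝒳).left ≫ 𝒳.hom = L.mul ≫ 𝒳.hom := by rw [hfstS, L.mul_comp]
    calc (t.fst ≫ L.dom.ι) ≫ (snd 𝒳 𝒳).left = t.fst ≫ L.dom.ι ≫ (snd 𝒳 𝒳).left := Category.assoc _ _ _
      _ = t.snd ≫ 𝒳.hom ≫ s := cone_snd t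
      _ = (t.fst ≫ L.mul) ≫ 𝒳.hom ≫ s := by rw [cone_mul t]
      _ = t.fst ≫ (L.mul ≫ 𝒳.hom) ≫ s := by simp only [Category.assoc]
      _ = t.fst ≫ (L.dom.ι ≫ (fst 𝒳 𝒳).left ≫ 𝒳.hom) ≫ s := congrArg (fun φ => t.fst ≫ φ ≫ s) hmulS.symm
      _ = (t.fst ≫ L.dom.ι ≫ (fst 𝒳 𝒳).left) ≫ 𝒳.hom ≫ s := by simp only [Category.assoc]
  have cone_range : ∀ t : PullbackCone L.shearRight.left σ.left,
      Set.range (t.fst ≫ L.dom.ι ≫ (fst 𝒳 𝒳).left).base ⊆ Set.range A.ι.base := fun t =>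
    hrangeA _ (by rw [cone_slice t]; rintro _ ⟨x, rfl⟩; exact ⟨t.fst.base x, rfl⟩)
  -- … and is cartesian, so `ρ` is an open immersion (base change of `Ψ`)
  have hpb : IsPullback e ρ L.shearRight.left σ.left := by
    refine IsPullback.of_isLimit' ⟨hsq⟩ (PullbackCone.IsLimit.mk hsq
      (fun t => IsOpenImmersion.lift A.ι (t.fst ≫ L.dom.ι ≫ (fst 𝒳 𝒳).left) (cone_range t))
      (fun t => ?_) (fun t => ?_) (fun t m hm₁ _ => ?_))
    · -- `lift ≫ e = t.fst`
      rw [← cancel_mono L.dom.ι, Category.assoc, he, ← Category.assoc, IsOpenImmersion.lift_fac]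
      exact cone_slice t
    · -- `lift ≫ ρ = t.snd`
      change IsOpenImmersion.lift A.ι (t.fst ≫ L.dom.ι ≫ (fst 𝒳 𝒳).left) _ ≫ (e ≫ L.mul) = t.snd
      have hfac : IsOpenImmersion.lift A.ι (t.fst ≫ L.dom.ι ≫ (fst 𝒳 𝒳).left) (cone_range t) ≫ e = t.fst := by
        rw [← cancel_mono L.dom.ι, Category.assoc, he, ← Category.assoc, IsOpenImmersion.lift_fac]
        exact cone_slice t
      rw [← Category.assoc, hfac]
      exact cone_mul t
    · -- uniqueness
      rw [← cancel_mono A.ι, IsOpenImmersion.lift_fac, ← hm₁]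
      simp only [Category.assoc]
      rw [reassoc_of% he, hσ1, Category.comp_id]
  have hρo : IsOpenImmersion ρ :=
    MorphismProperty.IsStableUnderBaseChange.of_isPullback (P := @IsOpenImmersion) hpb hΨo
  -- pointwise description
  have hpt : ∀ a : ↥A, ∃ z : ↥L.dom, L.dom.ι.base z = σ.left.base (A.ι.base a) ∧ ρ.base a = L.mul.base z :=
    fun a => ⟨e.base a, he_base a, rfl⟩
  have hsurj : ∀ z : ↥L.dom, (snd 𝒳 𝒳).left.base (L.dom.ι.base z) = s.base ((𝒳 ⊗ 𝒳).hom.base (L.dom.ι.base z)) →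
      ∃ a : ↥A, L.dom.ι.base z = σ.left.base (A.ι.base a) ∧ ρ.base a = L.mul.base z := by
    intro z hz
    obtain ⟨a₀, ha₀, -⟩ := exists_sectionSlice_eq 𝒳 s hs (L.dom.ι.base z) _ hz
    have hmem : a₀ ∈ A := (memA a₀).2 (by
      rw [ha₀, ← SetLike.mem_coe, ← Scheme.Opens.range_ι]; exact ⟨z, rfl⟩)
    have : a₀ ∈ Set.range A.ι.base := by rw [Scheme.Opens.range_ι]; exact hmem
    obtain ⟨a, ha⟩ := this
    refine ⟨a, by rw [ha, ha₀], ?_⟩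
    have hz' : e.base a = z := L.dom.ι.isOpenEmbedding.injective (by rw [he_base, ha, ha₀])
    change L.mul.base (e.base a) = _
    rw [hz']
  refine ⟨A, e, ρ, he, rfl, hρo, hρS, memA, hpt, hsurj, fun hstrict hirr => ?_⟩
  -- densities from strictness (slice of `dom` over the point `s t` in the `snd` direction)
  haveI := hρo
  have hA : IsFibrewiseDense 𝒳.hom (A : Set 𝒳.left) := by
    refine IsFibrewiseDense.of_isOpen_of_forall_nonempty A.isOpen hirr fun t ⟨v, hv⟩ => ?_
    obtain ⟨⟨-, hdense⟩, -, -⟩ := hstrict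
    have hvF : σ.left.base v ∈ (snd 𝒳 𝒳).left.base ⁻¹' {s.base t} := by
      change (snd 𝒳 𝒳).left.base (σ.left.base v) = s.base t
      rw [σ_snd_base]
      exact congrArg s.base hv
    obtain ⟨w, hwdom, hwF⟩ := hdense.nonempty_inter_fibre ⟨_, hvF⟩
    obtain ⟨a, ha, hat⟩ := exists_sectionSlice_eq 𝒳 s hs w t hwF
    exact ⟨a, (memA a).2 (by rw [ha]; exact hwdom), hat⟩
  refine ⟨hA, IsFibrewiseDense.of_isOpen_of_forall_nonempty ρ.isOpenEmbedding.isOpen_range hirr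
    fun t ht => ?_⟩
  obtain ⟨a₀, ha₀A, ha₀t⟩ := hA.nonempty_inter_fibre ht
  have : a₀ ∈ Set.range A.ι.base := by rw [Scheme.Opens.range_ι]; exact ha₀A
  obtain ⟨a, rfl⟩ := this
  refine ⟨ρ.base a, ⟨a, rfl⟩, ?_⟩
  change (ρ ≫ 𝒳.hom).base a = t
  rw [hρS]
  exact ha₀t

end BirationalGroupLaw

end Literature.AlgebraicGeometry.GroupSchemes

end
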